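/-
Origin: expansion seat `planner-pub-hodgecm-pv11-0`, handover 2026-08-18T03:47:21Z (`HOME/pub-hodgecm-pv11/lean/Pv11/EqBasicDatum.lean`, md5 97e7aa18, 66 lines);
landed by the gen-5 packager in gate run 20 as `HodgeCM/PerL34/EqBasicDatum.lean` (verbatim).
-/
/-
Copyright: pub-hodgecm cell, 2026-08-18.  Seat pv11 (planner-pub-hodgecm-pv11-0), DAG node N31c — wrapper over the
LANDED shared vocabulary `HodgeCM.PerL34.Doubling` (pv05, gate run 18).
-/
import Summits.HodgeConjecture.HodgeCM.PerL34.Doubling_2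
import Summits.HodgeConjecture.HodgeCM.PerL34.EqBasic

/-!
# N31c over `DoublingDatum`: the two-variable basic identity (eq:basic), PerL v5 tex ll. 563–569

VERBATIM (ll. 563–569): "Consequently the Siegel–Weil section `f_Φ(h,s₀) := (ω^□(h)Φ)(0)`, `Φ := δ(φ⊗φ̄)`,
`s₀ = (dim V₃ − dim W_i)/2 = 1`, satisfies the *two-variable basic identity*
  (eq:basic)  `f_Φ(ι(h₁,h₂),s₀) = χ_V(h₂) ⟨ω(h₁)φ, ω(h₂)φ⟩   (h₁,h₂ ∈ U(W_i)(𝔸))`,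
by equivariance of `δ`: `ω^□(ι(h₁,h₂))δ(φ₁⊗φ̄₂) = δ(ω(h₁)φ₁ ⊗ χ_V(h₂)\overline{ω(h₂)φ₂})`, so
`f_Φ(ι(h₁,h₂),s₀) = χ_V(h₂)(δ(ω(h₁)φ ⊗ \overline{ω(h₂)φ}))(0)`."

The landed `HodgeCM/PerL34/EqBasic.lean` (this seat, run 18) proves (eq:basic) over unbundled variables
(`χ_V : A →* Circle`).  This file restates it over pv05's LANDED bundled datum `HodgeCM.PerL34.Doubling.DoublingDatum`
(`χV : A →* ℂ` with `‖χV a‖ = 1`, PerL's bracket `pair φ₁ φ₂ = ⟪φ₂, φ₁⟫_ℂ`), so that N31d/N31e consumers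
(`SiegelWeil`, `RallisUnfold`, …) can quote (eq:basic) by name on the shared structure.  KERNEL-PROVED from the datum's
two PRINT hypothesis fields `equivariant`, `ev0_δ` ([GQT] §11.3 closing displays, quoted verbatim in `Doubling.lean`);
nothing new is posited.  Kind: L1 (assembly over landed files).
-/

set_option autoImplicit false

namespace HodgeCM.PerL34.Doubling.DoublingDatum

open HodgeCM.PerL34.Doubling

variable {A H S Sbox : Type*} [CommGroup A] [Group H]
  [NormedAddCommGroup S] [InnerProductSpace ℂ S] [AddCommGroup Sbox] [Module ℂ Sbox]
  (D : DoublingDatum A H S Sbox)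

/-- PerL l. 569, the intermediate step: `f_Φ(ι(h₁,h₂),s₀) = χ_V(h₂)·(δ(ω(h₁)φ ⊗ \overline{ω(h₂)φ}))(0)`. -/
theorem fSW_Φ_ι (φ : S) (h₁ h₂ : A) :
    D.fSW (D.Φ φ) (D.ι (h₁, h₂)) = D.χV h₂ * D.ev0 (D.δ (D.ω h₁ φ) (D.ω h₂ φ)) := by
  rw [Φ_def, fSW_def, D.equivariant, map_smul, smul_eq_mul]

/-- **(eq:basic), PerL v5 l. 566, N31c over the shared datum:**
`f_Φ(ι(h₁,h₂),s₀) = χ_V(h₂) ⟨ω(h₁)φ, ω(h₂)φ⟩` for `h₁, h₂ ∈ U(W_i)(𝔸)`, `Φ = δ(φ⊗φ̄)`. -/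
theorem eq_basic (φ : S) (h₁ h₂ : A) :
    D.fSW (D.Φ φ) (D.ι (h₁, h₂)) = D.χV h₂ * pair (D.ω h₁ φ) (D.ω h₂ φ) := by
  rw [fSW_Φ_ι, D.ev0_δ]

/-- (eq:basic) on the diagonal `h₁ = h₂ = h` (unitarity of `ω(h)`): `f_Φ(ι(h,h),s₀) = χ_V(h)‖φ‖²` — the
form in which it enters the constant-term / Siegel–Weil computation (N31d). -/
theorem eq_basic_diag (φ : S) (h : A) :
    D.fSW (D.Φ φ) (D.ι (h, h)) = D.χV h * ((‖φ‖ : ℂ)) ^ 2 := by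
  rw [eq_basic, pair_map_map, pair_self]

/-- (eq:basic) at the identity: `f_Φ(1,s₀) = Φ(0) = ⟨φ,φ⟩ = ‖φ‖²` (tex l. 562–563), non-zero for `φ ≠ 0`. -/
theorem fSW_Φ_one (φ : S) : D.fSW (D.Φ φ) 1 = ((‖φ‖ : ℂ)) ^ 2 := by
  rw [Φ_def, fSW_one, pair_self]

/-- (Ported verbatim from the HodgeCMPerL package; no docstring in the source.) -/
theorem fSW_Φ_one_ne_zero {φ : S} (hφ : φ ≠ 0) : D.fSW (D.Φ φ) 1 ≠ 0 := by
  rw [Φ_def, fSW_one]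
  exact pair_self_ne_zero hφ

/-- Consistency with the unbundled run-18 statement `HodgeCM.PerL34.EqBasic.fSW_iota_eq_chi_mul_ev0`: the datum's
`fSW`/`Φ` are the unbundled ones (definitional). -/
theorem fSW_eq_unbundled (Ψ : Sbox) (x : H) : D.fSW Ψ x = HodgeCM.PerL34.EqBasic.fSW D.ωbox D.ev0 Ψ x := rfl

/-- (Ported verbatim from the HodgeCMPerL package; no docstring in the source.) -/
theorem Φ_eq_unbundled (φ : S) : D.Φ φ = HodgeCM.PerL34.EqBasic.PhiOf D.δ φ := rfl

end HodgeCM.PerL34.Doubling.DoublingDatum
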